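import Literature.Probability.RandomPlanarGeometry.LoewnerHullHitting
import Literature.Probability.RandomPlanarGeometry.LoewnerBoundaryExtension
import Literature.Probability.RandomPlanarGeometry.LoewnerInverse
import Literature.Probability.RandomPlanarGeometry.LoewnerPointFlow
import Literature.Analysis.Complex.LengthAreaDiameter
import HarnessLib

/-!
# Boundary values of the Loewner map at hull points; smallness on small connected sets

Deterministic facts about the chordal Loewner map `g_τ = Loewner.map W τ` of a continuous driving
function `W` on its domain `H_τ = Loewner.domain W τ = {z ∈ ℍ : τ < T_z}`, used in the proof of
the sector claim of [LSW] Lemma 6.3 (G. F. Lawler, O. Schramm, W. Werner, *Conformal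
restriction: the chordal case*, J. Amer. Math. Soc. **16** (2003), proof of Lemma 6.3;
`Literature/Probability/RandomPlanarGeometry/SLERestrictionHitPath*`), all PROVED:

* `Loewner.exists_forall_im_map_lt_of_swallowingTime_le` — **`im g_τ(z) → 0` as `z ∈ H_τ` tends
  to a swallowed point `q ∈ ℍ`, `T_q ≤ τ`**: the imaginary part decreases along the flow
  (`im_map_le_im_map`), `g_s` is continuous at `q` for `s < T_q`, and `im g_s(q) → 0` as
  `s ↑ T_q` because the trajectory of `q` runs into the driving function
  (`tendsto_map_sub_driving_of_swallowingTime_eq`, `LoewnerHullHitting`);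
* `Loewner.exists_forall_norm_map_sub_self_le` — a uniform bound `‖g_τ z - z‖ ≤ C₀` on `H_τ`
  (`norm_map_sub_self_le_of_mem_domain`, `LoewnerBoundaryExtension`);
* `Loewner.exists_norm_map_sub_map_le_of_isPreconnected` — **smallness of `g_τ` on small
  connected sets**: `‖g_τ z₁ - g_τ z₂‖ ≤ C / √(log (1/d))` for `z₁, z₂` in a preconnected
  `Q ⊆ H_τ` of diameter `< d < 1` (precisely `Q ⊆ B(p, d)`), with `C` depending on `W, τ` only —
  Wolff's length–area lemma in the form `Literature.Analysis.Complex.LengthArea.norm_sub_le_of_isPreconnected`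
  (`LengthAreaDiameter`) applied to the conformal bijection `g_τ : H_τ → ℍ`, `g_τ⁻¹ = loewnerInv`;
* `Loewner.deriv_map_ne_zero` — `g_τ' ≠ 0` on `H_τ` (the derivative is an exponential,
  `hasDerivAt_map`).

## References

* G. F. Lawler, O. Schramm, W. Werner, *Conformal restriction: the chordal case* (2003), proof of
  Lemma 6.3. [LawlerSchrammWerner2003Restriction]
* G. F. Lawler, *Conformally Invariant Processes in the Plane*, AMS (2005), §4.1. [Lawler2005]
* Ch. Pommerenke, *Boundary Behaviour of Conformal Maps* (1992), Prop. 2.2. [PommerenkeBBCM1992]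
-/

noncomputable section

open Set Filter Metric Complex
open _root_.Topology
open UpperHalfPlane (upperHalfPlaneSet isOpen_upperHalfPlaneSet)
open scoped NNReal

namespace Literature.Probability.RandomPlanarGeometry

namespace Loewner

variable {W : ℝ≥0 → ℝ}

/-! ### `im g_τ → 0` at swallowed points -/

/-- **The imaginary part of the Loewner map vanishes at swallowed points of `ℍ`.** If `q ∈ ℍ` is
swallowed by time `τ` (`T_q ≤ τ`), then for every `ε > 0` there is `ρ > 0` such that every point
`z` of the domain `H_τ` with `‖z - q‖ < ρ` has `im g_τ(z) < ε`. [cite: Lawler2005, Ch. 4 §4.1 (eq. (4.5), T_z)] -/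
theorem exists_forall_im_map_lt_of_swallowingTime_le (hW : Continuous W) {q : ℂ} (hq : 0 < q.im)
    {τ : ℝ≥0} (hqτ : swallowingTime W q ≤ (τ : WithTop ℝ≥0)) {ε : ℝ} (hε : 0 < ε) :
    ∃ ρ > 0, ∀ z ∈ domain W τ, ‖z - q‖ < ρ → (map W τ z).im < ε := by
  -- `T_q = σ` is finite and positive
  obtain ⟨σ, hσ⟩ : ∃ σ : ℝ≥0, swallowingTime W q = σ := by
    have : swallowingTime W q ≠ ⊤ := ne_top_of_le_ne_top WithTop.coe_ne_top hqτ
    obtain ⟨σ, hσ⟩ := WithTop.ne_top_iff_exists.1 this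
    exact ⟨σ, hσ.symm⟩
  have hσpos : 0 < σ := by
    have := swallowingTime_pos_holds hW (ne_driving_of_im_pos hq 0)
    rw [hσ] at this
    exact_mod_cast this
  have hστ : σ ≤ τ := by
    have := hqτ; rw [hσ] at this; exact_mod_cast this
  -- a time `s < σ` with `‖g_s q - W_s‖ < ε/2`
  have hlim := tendsto_map_sub_driving_of_swallowingTime_eq hW hq hσ
  haveI : (𝓝[<] σ).NeBot := nhdsLT_neBot_of_exists_lt ⟨0, hσpos⟩
  obtain ⟨s, hs1, hs2⟩ := ((Metric.tendsto_nhds.1 hlim (ε / 2) (half_pos hε)).and self_mem_nhdsWithin).exists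
  rw [dist_zero_right] at hs1
  replace hs2 : s < σ := hs2
  have hsq : (s : WithTop ℝ≥0) < swallowingTime W q := by rw [hσ]; exact_mod_cast hs2
  have him_s : (map W s q).im < ε / 2 := by
    have h1 : (map W s q).im = (map W s q - W s).im := by simp
    rw [h1]
    exact lt_of_le_of_lt ((abs_le.1 (abs_im_le_norm _)).2) hs1
  -- continuity of `g_s` at `q`
  have hcont := continuousAt_map hW hsq
  rw [Metric.continuousAt_iff] at hcont
  obtain ⟨ρ, hρ, hρcont⟩ := hcont (ε / 2) (half_pos hε)
  refine ⟨ρ, hρ, fun z hz hzq ↦ ?_⟩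
  rw [mem_domain_iff] at hz
  have hzτ : (τ : WithTop ℝ≥0) < swallowingTime W z := hz.2
  have h1 : (map W τ z).im ≤ (map W s z).im := im_map_le_im_map hW hz.1 (hs2.le.trans hστ) hzτ
  have h2 : dist (map W s z) (map W s q) < ε / 2 := hρcont (by rwa [dist_eq_norm])
  rw [dist_eq_norm] at h2
  have h3 : (map W s z).im ≤ (map W s q).im + ‖map W s z - map W s q‖ := by
    have := (abs_le.1 (abs_im_le_norm (map W s z - map W s q))).2
    rw [sub_im] at this; linarith
  linarith

/-- Variant at a point of the closed hull in `ℍ`: membership `q ∈ closedHull W τ` with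
`0 < im q` unfolds to `T_q ≤ τ`. [folklore] -/
theorem exists_forall_im_map_lt_of_mem_closedHull (hW : Continuous W) {q : ℂ} (hq : 0 < q.im)
    {τ : ℝ≥0} (hqτ : q ∈ closedHull W τ) {ε : ℝ} (hε : 0 < ε) :
    ∃ ρ > 0, ∀ z ∈ domain W τ, ‖z - q‖ < ρ → (map W τ z).im < ε :=
  exists_forall_im_map_lt_of_swallowingTime_le hW hq hqτ.2 hε

/-! ### A uniform displacement bound and the length–area smallness -/

/-- **Uniform displacement bound**: `‖g_τ z - z‖ ≤ C₀` on `H_τ` for some `C₀ ≥ 0` depending only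
on `W` and `τ` (`2 · sup_{[0,τ]} |W| + 13 √τ`). [cite: Lawler2005, Ch. 4 §4.1 (Prop. 4.x, |g_t(z) - z|)] -/
theorem exists_forall_norm_map_sub_self_le (hW : Continuous W) (τ : ℝ≥0) :
    ∃ C₀ : ℝ, 0 ≤ C₀ ∧ ∀ z ∈ domain W τ, ‖map W τ z - z‖ ≤ C₀ := by
  have hcont : Continuous fun u : ℝ ↦ ((W u.toNNReal : ℝ) : ℂ) :=
    continuous_ofReal.comp (hW.comp continuous_real_toNNReal)
  obtain ⟨M, hM⟩ := isCompact_Icc.exists_bound_of_continuousOn (s := Icc (0 : ℝ) τ) hcont.continuousOn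
  have hM' : ∀ u ∈ Icc (0 : ℝ) τ, ‖((W u.toNNReal : ℝ) : ℂ) - (0 : ℂ)‖ ≤ M := fun u hu ↦ by
    rw [sub_zero]; exact hM u hu
  have hM0 : 0 ≤ M := (norm_nonneg _).trans (hM 0 ⟨le_rfl, τ.coe_nonneg⟩)
  refine ⟨2 * M + 13 * Real.sqrt τ, by positivity, fun z hz ↦ ?_⟩
  exact norm_map_sub_self_le_of_mem_domain hW hM' hz

/-- **Smallness of the Loewner map on small connected sets** (Wolff's length–area lemma for the
conformal bijection `g_τ : H_τ → ℍ`): there is `C > 0`, depending only on `W` and `τ`, such that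
for every preconnected `Q ⊆ H_τ` contained in a disc `B(p, d)` with `0 < d < 1` and all
`z₁, z₂ ∈ Q`, `‖g_τ z₁ - g_τ z₂‖ ≤ C / √(log (1/d))`. [cite: PommerenkeBBCM1992, Prop. 2.2 (length–area)] -/
theorem exists_norm_map_sub_map_le_of_isPreconnected (hW : Continuous W) (τ : ℝ≥0) :
    ∃ C : ℝ, 0 < C ∧ ∀ {p : ℂ} {d : ℝ} {Q : Set ℂ}, 0 < d → d < 1 → IsPreconnected Q →
      Q ⊆ domain W τ → Q ⊆ ball p d →
        ∀ z₁ ∈ Q, ∀ z₂ ∈ Q, ‖map W τ z₁ - map W τ z₂‖ ≤ C / Real.sqrt (Real.log (1 / d)) := by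
  obtain ⟨C₀, hC₀, hC⟩ := exists_forall_norm_map_sub_self_le hW τ
  refine ⟨8 * Real.pi * (1 + C₀), by positivity, fun {p d Q} hd hd1 hQ hQU hQd z₁ hz₁ z₂ hz₂ ↦ ?_⟩
  have hfU : MapsTo (loewnerInv W τ) upperHalfPlaneSet (domain W τ) := fun w hw ↦
    loewnerInv_mem_domain hW τ hw
  have hfc : ContinuousOn (loewnerInv W τ) upperHalfPlaneSet := fun w hw ↦
    (continuousAt_loewnerInv hW τ hw).continuousWithinAt
  exact Literature.Analysis.Complex.LengthArea.norm_sub_le_of_isPreconnected (isOpen_domain hW τ)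
    (differentiableOn_map hW τ) (mapsTo_map hW τ) hfU hfc (fun w hw ↦ map_loewnerInv hW τ hw)
    (fun z hz ↦ loewnerInv_map hW hz) hC hd hd1 hQ hQU hQd hz₁ hz₂

/-- **Corollary (oscillation form).** With `C` as above: if moreover some values `g_τ(zₙ)`,
`zₙ ∈ Q`, come arbitrarily close to a point `w₀`, then `‖g_τ z - w₀‖ ≤ C / √(log (1/d))` on `Q`.
[folklore] -/
theorem norm_map_sub_le_of_isPreconnected_of_closure {τ : ℝ≥0} {C : ℝ}
    (hC : ∀ {p : ℂ} {d : ℝ} {Q : Set ℂ}, 0 < d → d < 1 → IsPreconnected Q →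
      Q ⊆ domain W τ → Q ⊆ ball p d →
        ∀ z₁ ∈ Q, ∀ z₂ ∈ Q, ‖map W τ z₁ - map W τ z₂‖ ≤ C / Real.sqrt (Real.log (1 / d)))
    {p : ℂ} {d : ℝ} {Q : Set ℂ} (hd : 0 < d) (hd1 : d < 1) (hQ : IsPreconnected Q)
    (hQU : Q ⊆ domain W τ) (hQd : Q ⊆ ball p d) {w₀ : ℂ} (hw₀ : w₀ ∈ closure (map W τ '' Q))
    {z : ℂ} (hz : z ∈ Q) : ‖map W τ z - w₀‖ ≤ C / Real.sqrt (Real.log (1 / d)) := by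
  refine le_of_forall_pos_lt_add fun ε hε ↦ ?_
  obtain ⟨w, ⟨z₂, hz₂, rfl⟩, hw⟩ := Metric.mem_closure_iff.1 hw₀ ε hε
  calc ‖map W τ z - w₀‖ ≤ ‖map W τ z - map W τ z₂‖ + ‖map W τ z₂ - w₀‖ := norm_sub_le_norm_sub_add_norm_sub _ _ _
    _ < C / Real.sqrt (Real.log (1 / d)) + ε := by
        have h1 := hC hd hd1 hQ hQU hQd z hz z₂ hz₂
        rw [dist_comm, dist_eq_norm] at hw
        linarith

/-! ### The derivative does not vanish -/

/-- **`g_τ' (z) ≠ 0` on the domain**: the derivative of the Loewner map is an exponential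
(`hasDerivAt_map`). [cite: Lawler2005, Ch. 4 §4.1 (eq. for g_t')] -/
theorem deriv_map_ne_zero (hW : Continuous W) {τ : ℝ≥0} {z : ℂ}
    (hz : (τ : WithTop ℝ≥0) < swallowingTime W z) : deriv (map W τ) z ≠ 0 := by
  obtain ⟨g, hg⟩ := exists_isSolution_swallowingTime_holds hW (ne_driving_of_lt_swallowingTime hz)
  rw [(hasDerivAt_map hW hz hg).deriv]
  exact Complex.exp_ne_zero _

end Loewner

end Literature.Probability.RandomPlanarGeometry
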